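import Summits.Ventures.WeilGRH.DualTrigUniversalSliver
import Summits.Ventures.WeilGRH.UniformConductorFloorCellsBudget
import HarnessLib

/-!
# Universal rungs: archimedean-only D-K certificate × cell certificate for the prime pattern

Cell `rh-explicit`, WEIL TRACK — GRH ARM (weil-grh-3 route B × weil-grh-1 uniform floors).  The uniform
conductor floor for a rung `t` factors as `log q* = A + P`: an ARCHIMEDEAN budget `A` with
`(1/2π)∫|ĝ(1/2+iτ)|² Re ψ(1/4 + a/2 + iτ/2) dτ ≥ −(A − log π)… ` precisely `≥ (log π − A)‖g‖₂²` on `C(t)`, and a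
PRIME budget `P` with `|P_χ(g ⋆ g̃)| ≤ P‖g‖₂²` for every character.  This file combines the best landed piece of
each kind:

* `A = log c.q` from a kernel-checked archimedean-only format-D-K certificate `c` (`DualTrigUniversalSliver.lean`,
  `DKCert.arch_integral_ge_of_check`; LP-tight: `log c.q ≈ −ℓ_a(t)`, the archimedean bottom on `C(t)`),
* `P = ρ` from weil-grh-1's CELL CERTIFICATE for the positivity-preserving translation pattern
  `S⁺_t = Σ_n (Λ(n)/√n)(τ_{log n} + τ_{−log n})` on `L²[−t, t]` (`UniformConductorFloorCellsBudget.lean`,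
  `UniformFloor.sum_two_mul_norm_weilConv_le_of_cert`: `J` linear cell inequalities for a step weight `φ`).

**THEOREM** (`DKCert.weilPositivityOnChar_universal_of_check_of_cells`): `log c.q + ρ ≤ log q ⇒ WeilPositivityOnChar χ t`
for EVERY Dirichlet character `χ` mod `q ≠ 1` of parity `c.par` — uniform in the values of `χ`, no `ζ` input.
With the landed numbers (`log 18`, `log 7` at `t = (log 8)/2 ⊇ 1`; `ρ = 2.1506` at `t = 1`) the floor at `t = 1`
becomes `18·e^{2.1506} ≈ 155` (even) / `7·e^{2.1506} ≈ 60` (odd), against `256 / 80` (cells + Lorentzian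
archimedean budget) and `576 / 216` (archimedean certificate + sliver budget).  Also recorded: the same with
an ABSTRACT prime budget (`…_of_primeBudget`), for any future bound `‖P_χ(g ⋆ g̃)‖ ≤ P‖g‖₂²`.
Everything here is PROVED; no named facts, no `sorry`, no kernel evaluation.

## References

* A. Weil (1952), (11) pp. 261–262 and the «lemme» p. 262 [Weil1952FormulesExplicites]; H. Yoshida (1992), §2
  [Yoshida1992].
-/

noncomputable section

open Complex Set MeasureTheory Finset Real

namespace Summit.Ventures.WeilGRH

open Literature.Analysis.ValidatedNumerics.NumericsMP
open Literature.NumberTheory.LFunctions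
open scoped ArithmeticFunction.vonMangoldt

namespace DKCert

variable {c : DKCert} {q : ℕ}

/-- **Archimedean certificate × abstract prime budget.**  If `c.check = true` with the empty window,
`e^{2t} ≤ N' + 1`, the atoms are admissible for `N'`, and the prime term obeys `‖P_χ(g ⋆ g̃)‖ ≤ P‖g‖₂²` for every
test function supported in `[−t, t]`, then `log c.q + P ≤ log q ⇒ WeilPositivityOnChar χ t` for every character
`χ` mod `q ≠ 1` of parity `c.par`. [cite: Weil1952FormulesExplicites, (11) pp. 261–262 and the «lemme» p. 262] -/
theorem weilPositivityOnChar_universal_of_check_of_primeBudget (hc : c.check = true) (hN : c.N = 1)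
    (hv : c.vals = []) {t : ℝ} {N' : ℕ} (hN' : Real.exp (2 * t) ≤ (N' : ℝ) + 1)
    (hadm : (c.atoms.all fun atm => decide ((N' + 1) ^ c.D ≤ c.p0 ^ atm.k)) = true)
    (hq1 : q ≠ 1) (χ : DirichletCharacter ℂ q) (hpar : charParity χ = c.par) {P : ℝ}
    (hP : ∀ g : ℝ → ℂ, IsWeilTest g → tsupport g ⊆ Icc (-t) t →
      ‖weilPrimeTermChar χ (weilConv g (weilReflect g))‖ ≤ P * weilNorm2Sq g)
    (hlog : Real.log c.q + P ≤ Real.log q) :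
    WeilPositivityOnChar χ t := by
  intro g hg hsupp
  set k := weilConv g (weilReflect g) with hk
  set N2 := weilNorm2Sq g with hN2
  have hN20 : 0 ≤ N2 := integral_nonneg fun _ ↦ by positivity
  set A : ℝ := ∫ τ : ℝ, ‖weilMellin g (1 / 2 + τ * I)‖ ^ 2 *
    (digamma ((((1 / 4 + (c.par : ℝ) / 2 : ℝ)) : ℂ) + ((τ / 2 : ℝ) : ℂ) * I)).re with hA
  have hre : (weilQuadraticChar χ g).re =
      -(weilPrimeTermChar χ k).re + (1 / (2 * π) * A + N2 * (Real.log q - Real.log π)) := by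
    rw [UniformFloor.weilQuadraticChar_eq_neg_prime_add hq1 χ hpar hg, Complex.add_re, Complex.neg_re,
      Complex.ofReal_re]
  have hPr : (weilPrimeTermChar χ k).re ≤ P * N2 := (Complex.re_le_norm _).trans (hP g hg hsupp)
  have hArch : (Real.log π - Real.log c.q) * N2 ≤ 1 / (2 * π) * A :=
    arch_integral_ge_of_check hc hN hv hN' hadm χ hpar hg hsupp
  have hBN : (Real.log c.q + P) * N2 ≤ Real.log q * N2 := mul_le_mul_of_nonneg_right hlog hN20
  rw [hre]
  nlinarith

/-- **Archimedean certificate × cell certificate (weil-grh-1's `φ`-budget).**  Hypotheses: the archimedean-only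
certificate `c` (`check`, empty window, atoms admissible for `N'`, `e^{2t} ≤ N' + 1`), and a cell certificate
on `J` cells of `[−t, t]` (step weight `φ`, shift indices `s_n`, weights `w̄_n ≥ Λ(n)/√n`, constant `ρ`) as in
`UniformFloor.sum_two_mul_norm_weilConv_le_of_cert`.  Then `log c.q + ρ ≤ log q ⇒ WeilPositivityOnChar χ t`
for every character `χ` mod `q ≠ 1` of parity `c.par`. [cite: Weil1952FormulesExplicites, (11) pp. 261–262 and the «lemme» p. 262; Yoshida1992, §2] -/
theorem weilPositivityOnChar_universal_of_check_of_cells (hc : c.check = true) (hN : c.N = 1)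
    (hv : c.vals = []) {t : ℝ} (ht : 0 < t) {N' : ℕ} (hN' : Real.exp (2 * t) ≤ (N' : ℝ) + 1)
    (hadm : (c.atoms.all fun atm => decide ((N' + 1) ^ c.D ≤ c.p0 ^ atm.k)) = true)
    (hq1 : q ≠ 1) (χ : DirichletCharacter ℂ q) (hpar : charParity χ = c.par)
    {J : ℕ} (hJ : 0 < J) (φ : ℤ → ℝ) {Φ₀ Φ₁ : ℝ} (hΦ₀ : 0 < Φ₀)
    (hφlo : ∀ i, 0 ≤ i → i < (J : ℤ) → Φ₀ ≤ φ i) (hφhi : ∀ i, φ i ≤ Φ₁)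
    (hφout : ∀ i, i < 0 ∨ (J : ℤ) ≤ i → φ i = 0) (s : ℕ → ℕ)
    (hs : ∀ n ∈ Finset.range (N' + 1),
      ((s n : ℤ) : ℝ) * (2 * t / J) ≤ Real.log n ∧ Real.log n ≤ (((s n : ℤ) : ℝ) + 1) * (2 * t / J))
    (wbar : ℕ → ℝ) (hw : ∀ n ∈ Finset.range (N' + 1), (Λ n : ℝ) / Real.sqrt n ≤ wbar n) {ρ : ℝ}
    (hcert : ∀ j ∈ Finset.range J,
      ∑ n ∈ Finset.range (N' + 1), wbar n *
        (max (φ ((j : ℤ) - s n - 1)) (φ ((j : ℤ) - s n)) + max (φ ((j : ℤ) + s n)) (φ ((j : ℤ) + s n + 1))) ≤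
        ρ * φ (j : ℤ))
    (hlog : Real.log c.q + ρ ≤ Real.log q) :
    WeilPositivityOnChar χ t := by
  refine weilPositivityOnChar_universal_of_check_of_primeBudget hc hN hv hN' hadm hq1 χ hpar ?_ hlog
  intro g hg hsupp
  set k := weilConv g (weilReflect g) with hk
  have hkc : Continuous k := (hg.weilConv hg.weilReflect).1.continuous
  have hks : tsupport k ⊆ Icc (-(2 * t)) (2 * t) := tsupport_weilConv_weilReflect_subset hg.2 hsupp
  have hPn : ‖weilPrimeTermChar χ k‖ ≤
      ∑ n ∈ Finset.range (N' + 1), (Λ n : ℝ) / Real.sqrt n * (2 * ‖k (Real.log n)‖) := by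
    rw [weilPrimeTermChar_eq_sum_of_tsupport_subset χ hkc hN' hks]
    refine (norm_sum_le _ _).trans (Finset.sum_le_sum fun n _ ↦ ?_)
    have hΛ : 0 ≤ (Λ n : ℝ) / Real.sqrt n :=
      div_nonneg ArithmeticFunction.vonMangoldt_nonneg (Real.sqrt_nonneg _)
    have hcoef : ‖((Λ n : ℝ) : ℂ) / (Real.sqrt n : ℂ)‖ = (Λ n : ℝ) / Real.sqrt n := by
      rw [← Complex.ofReal_div, Complex.norm_real, Real.norm_of_nonneg hΛ]
    have hχ : ‖χ (n : ZMod q)‖ ≤ 1 := DirichletCharacter.norm_le_one χ _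
    have hneg : ‖k (-Real.log n)‖ = ‖k (Real.log n)‖ := by
      rw [hk, weilConv_weilReflect_neg, Complex.norm_conj]
    rw [norm_mul, hcoef]
    refine mul_le_mul_of_nonneg_left ?_ hΛ
    refine (norm_add_le _ _).trans ?_
    rw [norm_mul, norm_mul, Complex.norm_conj, hneg]
    have hk0 : 0 ≤ ‖k (Real.log n)‖ := norm_nonneg _
    nlinarith [mul_le_mul_of_nonneg_right hχ hk0]
  exact hPn.trans (UniformFloor.sum_two_mul_norm_weilConv_le_of_cert hg ht hsupp hJ φ hΦ₀ hφlo hφhi hφout N' s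
    hs wbar hw hcert)

end DKCert

end Summit.Ventures.WeilGRH

end
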